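import Summits.QuantumFields.YangMills.Theorems.BalabanUVNodesN11DiagonalOldBranchMeasurable
import Literature.MathematicalPhysics.QuantumFieldTheory.Balaban1983to89.Node00.Record13SepCoPHChi
import Literature.MathematicalPhysics.QuantumFieldTheory.Balaban1983to89.Node00.Record13ResidualsRChi
import Summits.QuantumFields.YangMills.Theorems.BalabanUVNodesN11NoExpansionAtRecord13CoPChi
import Summits.QuantumFields.YangMills.Theorems.BalabanUVNodesN11NoExpansionDiagonalCoPHChi
import Summits.QuantumFields.YangMills.Theorems.BalabanUVNodesN11BackgroundScaleLocalChi
import Summits.QuantumFields.YangMills.Theorems.BalabanUVNodesN11NoExpansionOldFactorsChi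
import Summits.QuantumFields.YangMills.Theorems.BalabanUVNodesN11NoExpansionGeneralStepCoPHOldBranchChi

/-!
# χ-GENERIC RE-ISSUE (WORK ORDER RC-1 «RE-CENTRE THE RECORD», director-ym №462 (B) ∕ №467 (D)) of `BalabanUVNodesN11DiagonalOldBranchMeasurable`

Cell `pub-ymgap` (HUMAN RULING D-0062, Track A), seat `pub-ymgap-dag-n11-d` (N11 [B14] s2; N11-σ campaign, `N11-G44-RC1-REACH-CENSUS.md`).  The CENTRE-TYPED
declarations of `BalabanUVNodesN11DiagonalOldBranchMeasurable` (those whose statement reads the (2.9) cut-off centre through `gOfRecord₁₃ ∕ EOfRecord₁₃ ∕ Provisos₁₃… ∕ T∕SLaw₁₃… ∕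
UbgOfRecord₁₃… ∕ WtOfRecord₁₃… ∕ datum∕tower∕coreOfRecord₁₃…`) RE-ISSUED VERBATIM in the β-slot `χ : ChiSlot F N` over [Ax-3b]∕[Ax-3c]∕[Ax-3d]'s χ-generic carriers
(`Node00/Record13Chi` ∕ `Record13CoPHChi` ∕ `Record13SepCoPHChi`): σ = (binder `(χ : ChiSlot F N)` after `θ`; Node00 defs `X ↦ XChi … χ`; Node00 rows `Y ↦ Y_chi`;
this lane's sibling modules `…Chi` for Summits-side dependencies); SAME short names in the sibling namespace `…BalabanUVNodesN11DiagonalOldBranchMeasurableChi` (consumers switch by namespace);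
the 7 centre-FREE declarations of the original are NOT copied — they are reused BY NAME (`open … (…)` below).  At `χ := chiβOfRecord₁₃ θ` every statement here is
DEFINITIONALLY the landed one ([Ax-3b]'s `rfl` receipts); at `χ := chiβOfRecord₁₃Ax θ` it is what the Ax-record's N11 machine reads.  Nothing of record edited (body-freeze №460 (2)).

HONEST FRAMING.  Count-neutral kernel re-elaboration of landed N11 bookkeeping∕estimates in a parameter; every HYPOTHESIS of the original stays a hypothesis; nothing of
Bałaban asserted beyond what the original file proves; N11 NOT discharged; K-items untouched; counts unmoved.  One finite `𝕋⁴_{L^K}` programme at fixed `ε = L^{−K}` —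
NOT ℝ⁴, NOT OS, NOT a mass gap, NOT Clay.  No `sorry`∕`instance`∕`notation`.  Sources: as the original module, plus [I] = [Balaban1987RG1] (2.9) p.266 (the cut-off's centre).
-/

noncomputable section

open MeasureTheory
open scoped BigOperators Matrix.Norms.L2Operator

namespace Summit.QuantumFields.YangMills.Theorems.BalabanUVNodesN11DiagonalOldBranchMeasurableChi

open Summit.QuantumFields.YangMills.Theorems.BalabanUVNodesN11DiagonalOldBranchMeasurable (measurable_ζ0_ZtOfRecord measurable_ζ0_ZrOfRecord₁₃_of_provisosCore measurable_quad_ZrOfRecord₁₃ measurable_sect2Operand_CoP_of_allLarge hmB_of_allLarge hmB_door_ofCured_of_allLarge exists_clause_succ_CoPH_door_ofCured_of_allLarge_of_hCB)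
open Literature.MathematicalPhysics.QuantumFieldTheory.Balaban1983to89 T4Continuum Node00 Node00.Tk DagBinding
open B15DeterminingSets
open BalabanUVNodesN11TkOpMeasurable
open BalabanUVNodesN11NoExpansionAllLargeCoP (sect2Operand_CoP_eq_of_allLarge init_allLarge)
open BalabanUVNodesN11NoExpansionDiagonalCoPH (sect2Operand_congr_residual)
open BalabanUVNodesN11NoExpansionDiagonalCoPHChi (WtOfRecord₁₃H_eq_tkWeightsOfRecordP)
open BalabanUVNodesN11NoExpansionGeneralStepCoPHDoor (chiSeqOfRecord_init_eq_one_of_allLarge hA_of_allLarge)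
open BalabanUVNodesN11NoExpansionGeneralStepCoPHOldBranch (exists_clause_succ_CoPH_of_Omega_empty_of_sLaw₁₃CoPH_of_oldBranch)

variable {F : T4Family} {N : ℕ} [NeZero N]

/-! ## §1  The residuals of record have measurable `ζ0_j(Y)` -/

section Residuals

variable (θ : Stage13Params F N) (χ : ChiSlot F N) (p : B12.RunParams)

variable {θ χ p}

/-- **node00-def-K0a's generation-`j` pin value is measurable** given the displayed joint measurability of def-T's step weight at the all-large index (row
`tstep.measW`): it reads `((ω j).1, avg_j (ω j).1)`. [cite: Balaban1988Convergent, (3.2)–(3.5) pp.264–265, (3.16) p.268 (bookkeeping)] -/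
theorem measurable_stepWeightPinOfRecord₁₃ (j : ℕ)
    (hmw : Measurable fun z : GaugeField (F.P p.K) (j + 1) (SU N) × GaugeField (F.P p.K) j (SU N) =>
      wOfRecord₉ F N θ.toStage9Params p (gOfRecord₁₃Chi F N θ χ p) j (seqAllLargeOfRecord F θ.ν θ.τ9.M (gOfRecord₁₃Chi F N θ χ p) p.K (j + 1)) z.2 z.1) :
    Measurable (stepWeightPinOfRecord₁₃Chi F N θ χ p j) := by
  have hV : Measurable fun ω : MultiCfg (F.P p.K) (SU N) (FluctV N) => (ω j).1 := measurable_fst.comp (measurable_pi_apply j)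
  have hg : Measurable fun ω : MultiCfg (F.P p.K) (SU N) (FluctV N) => ((avOfRecord F N p.K j).avg (ω j).1, (ω j).1) :=
    ((avOfRecord_measurable F N p.K j).comp hV).prodMk hV
  have h := hmw.comp hg
  exact h

/-- **★ node00-def-K0a's RUN-INDEXED RESIDUAL OF RECORD HAS MEASURABLE `ζ0_j(Y)`** for every `(j, Y)`, given `tstep.measW` at the all-large indices below `K`.
[cite: Balaban1988Convergent, p.267, (3.16)–(3.20) pp.268–269 (bookkeeping)] -/
theorem measurable_ζ0_ZrOfRecord₁₃
    (hmw : ∀ j, j < p.K → Measurable fun z : GaugeField (F.P p.K) (j + 1) (SU N) × GaugeField (F.P p.K) j (SU N) =>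
      wOfRecord₉ F N θ.toStage9Params p (gOfRecord₁₃Chi F N θ χ p) j (seqAllLargeOfRecord F θ.ν θ.τ9.M (gOfRecord₁₃Chi F N θ χ p) p.K (j + 1)) z.2 z.1)
    (j : ℕ) (Y : Set (Site (F.P p.K) 0)) : Measurable ((ZrOfRecord₁₃Chi F N θ χ p).ζ0 j Y) := by
  by_cases hj : j < p.K
  · by_cases hT : Y = Set.univ
    · subst hT
      rw [show (ZrOfRecord₁₃Chi F N θ χ p).ζ0 j Set.univ = stepWeightPinOfRecord₁₃Chi F N θ χ p j from funext fun ω => ZrOfRecord₁₃_ζ0_univ_chi hj ω]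
      exact measurable_stepWeightPinOfRecord₁₃ j (hmw j hj)
    · by_cases h0 : Y = ∅
      · subst h0
        rw [show (ZrOfRecord₁₃Chi F N θ χ p).ζ0 j ∅ = fun ω => 1 - stepWeightPinOfRecord₁₃Chi F N θ χ p j ω from funext fun ω => ZrOfRecord₁₃_ζ0_empty_chi hj ω]
        exact measurable_const.sub (measurable_stepWeightPinOfRecord₁₃ j (hmw j hj))
      · rw [show (ZrOfRecord₁₃Chi F N θ χ p).ζ0 j Y = fun _ => 0 from funext fun ω => ZrOfRecord₁₃_ζ0_of_ne_of_ne_chi hj hT h0 ω]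
        exact measurable_const
  · rw [show (ZrOfRecord₁₃Chi F N θ χ p).ζ0 j Y = (ZtOfRecord F N p.K).ζ0 j Y from funext fun ω => ZrOfRecord₁₃_ζ0_of_le_chi (Nat.not_lt.mp hj) Y ω]
    exact measurable_ζ0_ZtOfRecord p.K j Y

end Residuals

/-! ## §2  The 𝐓-weights of the v1.7 record are measurable when the history's residual is -/

section Weights

variable (θ : Stage13HParams F N) (χ : ChiSlot F N) (p : B12.RunParams)

/-- **THE 𝐓-WEIGHTS SERVING A HISTORY HAVE MEASURABLE `ζ_j(Y)`** when the residual serving it has. [cite: Balaban1988Convergent, (2.21) p.258, (3.16) p.268 (bookkeeping)] -/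
theorem measurable_WtOfRecord₁₃H_ζ {n : ℕ} (s : SeqOfRecord F θ.ν θ.τ9.M (gOfRecord₁₃Chi F N θ.toStage13Params χ p) p.K n) (j : ℕ) (Y : Set (Site (F.P p.K) 0))
    (hζ : Measurable ((θ.zhAtChi χ p s).ζ0 j Y)) : Measurable ((WtOfRecord₁₃HChi F N θ χ p s).ζ j Y) := by
  rw [WtOfRecord₁₃H_eq_tkWeightsOfRecordP]
  exact measurable_tkWeightsOfRecordP_ζ F N (FluctV N) θ.ν θ.A₁ p _ _ j Y hζ

/-- **… AND MEASURABLE A-WEIGHTS `w_j(Λ′, Y, S)`** when the residual's `quad_j(Λ′)` is (12a's `χA_j` is measurable, `…N11TkOpMeasurable`).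
[cite: Balaban1988Convergent, (2.21) p.258, (3.21) p.269, (3.23) p.270 (bookkeeping)] -/
theorem measurable_WtOfRecord₁₃H_w {n : ℕ} (s : SeqOfRecord F θ.ν θ.τ9.M (gOfRecord₁₃Chi F N θ.toStage13Params χ p) p.K n) (j : ℕ)
    (Λ' Y S : Set (Site (F.P p.K) 0)) (hq : Measurable ((θ.zhAtChi χ p s).quad j Λ')) : Measurable ((WtOfRecord₁₃HChi F N θ χ p s).w j Λ' Y S) := by
  rw [WtOfRecord₁₃H_eq_tkWeightsOfRecordP]
  exact measurable_tkWeightsOfRecordP_w F N (FluctV N) θ.ν θ.A₁ p _ _ j Λ' Y S hq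

end Weights

/-! ## §3  The §2 operand along the all-large-field history is measurable (it is `exp(−g₀⁻²A((ω 0).1) − E)`) -/

section Operand

variable (θ : Stage13Params F N) (χ : ChiSlot F N) (p : B12.RunParams)

end Operand

/-! ## §4  ★★ `hmB` along the diagonal: the OLD BRANCH is measurable for every v1.7 parameter whose residual serving `s′` has measurable `ζ0`, `quad` -/

section HmB

variable (θ : Stage13HParams F N) (χ : ChiSlot F N) (p : B12.RunParams)

end HmB

/-! ## §5  ★★★ The diagonal 𝐓-step at the door of K0a's cured witness from `Provisos₁₃Core` + `SLaw` + the old-branch BOUND `hCB` only -/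

section Door

variable (θ₀ : Stage13Params F N) (χ : ChiSlot F N) (p : B12.RunParams)

end Door

end Summit.QuantumFields.YangMills.Theorems.BalabanUVNodesN11DiagonalOldBranchMeasurableChi

end
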